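import Summits.KontsevichZagierPeriods.KontsevichZagierPeriods.Theorems.ValuedFieldSpecialisationCTConstructionCylinder
import Summits.KontsevichZagierPeriods.KontsevichZagierPeriods.Theorems.ValuedFieldSpecialisationCTConstructionElementarySliceValue

/-!
# Route ValuedFieldSpecialisation — crux `CTConstruction`: the `s`-weighted total of a log family

Helper toward crux stmt-KontsevichZagierPeriods-3495 (`CTConstruction`), line `registered`, stub
`stub_logFamily_weighted_total` (the lead's "moment method": from a fibred relation among
log-elementary families and constant families one extracts the TOTAL classes with weights `1` and
`s`). The log-elementary divergent product `P` with `p = 0`, `b = 1` over a coefficient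
representation `r : IntegralRep d` lives in coordinates `z = (s, u, y, w)`, domain
`0 < s < 1`, `0 < u < 1`, `s ≤ y ≤ 1`, `w ∈ r.domain`, integrand `y⁻¹ · r.integrand w`;
its `s`-weighted version `P'` (same domain cut by the parameter slab `0 < s < 1`, integrand
`s · y⁻¹ · r.integrand w`) has value `∫₀¹ s log (1/s) ds · r.value = r.value / 4`, and this
holds AT CLASS LEVEL: `4 • [P'] − [r] ∈ KZ.relations` (`stub_logFamily_weighted_total`).

Moves used (all of `KZ.relations`): a coordinate permutation to `(u, w, y, s)`
(`KZ.of_sub_of_reindex_mem_relations`); the null face `{s = 0} ∪ {s = 1}`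
(`KZ.IntegralRep.of_sub_of_restrict_mem_relations`); `4 [T] ≡ [4 T]` (integrand additivity);
Newton–Leibniz in `s` over the band `0 ≤ s ≤ y` with primitive `2 s² y⁻¹ r(w)`, giving
`[2 y r(w)]` on `{0 < y ≤ 1}` over the cylinder of `r`; the null face `{y = 0}`; Newton–Leibniz
in `y` over `0 ≤ y ≤ 1` with primitive `y² r(w)`, giving the constant family `r.cylinder`; and
`[r.cylinder] ≡ [r]` (`of_cylinder_sub_of_mem_relations`).

Sources: M. Kontsevich, D. Zagier, *Periods* (2001), §1.2 (rules (1)–(3)). No new definitions.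
-/

noncomputable section

namespace Summit.KontsevichZagierPeriods.ValuedFieldSpecialisation

open MeasureTheory Set Filter MvPolynomial
open Literature.NumberTheory.Transcendental Literature.NumberTheory.Transcendental.KZ
open Literature.ModelTheory.ExponentialFields (IsSemialgebraic isSemialgebraic_setOf_eval_pos
  isSemialgebraic_setOf_eval_lt isSemialgebraic_setOf_eval_le)

variable {m : ℕ}

/-! ### The coordinate permutation `(s, u, y, w) ↦ (u, w, y, s)` -/

/-- The coordinate relabelling `e` of `ℝ^{d+3}` with `z = w ∘ e` for `z = (s, u, y, w₁ … w_d)`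
and `w = (u, w₁ … w_d, y, s)`: `e 0 = d + 2`, `e 1 = 0`, `e 2 = d + 1`, `e (l + 3) = l + 1`.
[folklore] -/
theorem exists_coordPerm (d : ℕ) :
    ∃ e : Fin (1 + d + 1 + 1) ≃ Fin (d + 1 + 1 + 1),
      e 0 = Fin.last (d + 1 + 1) ∧ e 1 = 0 ∧
      (∀ j : Fin 1, e (Fin.castAdd d j).succ.succ = (Fin.last (d + 1)).castSucc) ∧
      ∀ l : Fin d, e (Fin.natAdd 1 l).succ.succ = l.succ.castSucc.castSucc := by
  refine ⟨{ toFun := fun i => Fin.cases (Fin.last (d + 1 + 1))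
              (fun i₁ : Fin (1 + d + 1) => Fin.cases ((0 : Fin (d + 1)).castSucc.castSucc)
                (fun i₂ : Fin (1 + d) =>
                  Fin.addCases (fun _ : Fin 1 => (Fin.last (d + 1)).castSucc)
                    (fun l : Fin d => l.succ.castSucc.castSucc) i₂) i₁) i
            invFun := fun j => Fin.lastCases (0 : Fin (1 + d + 1 + 1))
              (fun j₁ : Fin (d + 1 + 1) => Fin.lastCases ((Fin.castAdd d (0 : Fin 1)).succ.succ)
                (fun j₂ : Fin (d + 1) => Fin.cases ((0 : Fin (1 + d + 1)).succ)
                  (fun l : Fin d => ((Fin.natAdd 1 l).succ.succ : Fin (1 + d + 1 + 1))) j₂)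
                j₁) j
            left_inv := ?_
            right_inv := ?_ }, ?_, ?_, ?_, ?_⟩
  · intro i
    refine Fin.cases ?_ (fun i₁ => Fin.cases ?_
      (fun i₂ => Fin.addCases (fun j => ?_) (fun l => ?_) i₂) i₁) i
    pick_goal 3
    · obtain rfl : j = 0 := Fin.fin_one_eq_zero j
      simp only [Fin.cases_succ, Fin.addCases_left, Fin.lastCases_castSucc, Fin.lastCases_last]
    all_goals simp only [Fin.cases_zero, Fin.cases_succ, Fin.addCases_right,
      Fin.lastCases_castSucc, Fin.lastCases_last]
  · intro j
    refine Fin.lastCases ?_ (fun j₁ => Fin.lastCases ?_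
      (fun j₂ => Fin.cases ?_ (fun l => ?_) j₂) j₁) j
    all_goals simp only [Fin.lastCases_last, Fin.lastCases_castSucc, Fin.cases_zero,
      Fin.cases_succ, Fin.addCases_left, Fin.addCases_right]
  · simp only [Equiv.coe_fn_mk, Fin.cases_zero]
  · rw [← Fin.succ_zero_eq_one]
    simp only [Equiv.coe_fn_mk, Fin.cases_succ, Fin.cases_zero, Fin.castSucc_zero]
  · intro j
    simp only [Equiv.coe_fn_mk, Fin.cases_succ, Fin.addCases_left]
  · intro l
    simp only [Equiv.coe_fn_mk, Fin.cases_succ, Fin.addCases_right]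

/-! ### The base `{(u, w, y) | (u, w) ∈ r.cylinder, 0 < y ≤ 1}` -/

/-- The base `B = {x | init x ∈ (0,1) × ρ.domain, 0 < x_last ≤ 1}` of the outer band is
`ℚ`-semialgebraic (a cylinder cut by two polynomial inequalities; no Tarski–Seidenberg).
[Bochnak–Coste–Roy 1998, §2.1] [folklore] -/
theorem isSemialgebraic_logBase (ρ : IntegralRep m) :
    IsSemialgebraic ℚ {x : Fin (m + 1 + 1) → ℝ | Fin.init x ∈ ρ.cylinder.domain ∧
      0 < x (Fin.last (m + 1)) ∧ x (Fin.last (m + 1)) ≤ 1} := by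
  have h0 : IsSemialgebraic ℚ {x : Fin (m + 1 + 1) → ℝ | 0 < x (Fin.last (m + 1))} := by
    simpa using isSemialgebraic_setOf_eval_pos (k := ℚ) (R := ℝ)
      (X (Fin.last (m + 1)) : MvPolynomial (Fin (m + 1 + 1)) ℚ)
  have h1 : IsSemialgebraic ℚ {x : Fin (m + 1 + 1) → ℝ | x (Fin.last (m + 1)) ≤ 1} := by
    simpa using isSemialgebraic_setOf_eval_le (k := ℚ) (R := ℝ)
      (X (Fin.last (m + 1)) : MvPolynomial (Fin (m + 1 + 1)) ℚ) 1
  convert (ρ.cylinder.isSemialgebraic_domain.setOf_init_mem.inter h0).inter h1 using 1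
  ext x
  simp only [mem_setOf_eq, mem_inter_iff, and_assoc]

/-! ### The inner band: Newton–Leibniz in `y` over the cylinder of `ρ` -/

/-- The inner band representation `S = [{(v, y) | v ∈ r.cylinder, 0 ≤ y ≤ 1}, 2 y · ρ(w)]`
exists (semialgebraic: polynomial times the cylinder integrand; integrable: a bounded multiple of
the slab integrand `KZ.IntegralRep.integrableOn_slabDomain`). [Kontsevich–Zagier 2001, §1.2]
[folklore] -/
theorem exists_innerBand (ρ : IntegralRep m) :
    ∃ S : IntegralRep (m + 1 + 1),
      S.domain = KZlog.band ρ.cylinder.domain (fun _ => 0) (fun _ => 1) ∧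
      S.integrand = fun x => 2 * x (Fin.last (m + 1)) * ρ.cylinder.integrand (Fin.init x) := by
  set D : Set (Fin (m + 1 + 1) → ℝ) := KZlog.band ρ.cylinder.domain (fun _ => 0) (fun _ => 1)
  have hD : IsSemialgebraic ℚ D :=
    KZlog.isSemialgebraic_band
      (by simpa using isSemialgebraicFunOn_ratCast ρ.cylinder.isSemialgebraic_domain 0)
      (by simpa using isSemialgebraicFunOn_ratCast ρ.cylinder.isSemialgebraic_domain 1)
  have hDm : MeasurableSet D := IsSemialgebraic.measurableSet_holds hD
  have hsub : D ⊆ ρ.cylinder.slabDomain 0 := fun x hx =>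
    ⟨hx.1, by simpa using hx.2.1, by simpa using hx.2.2⟩
  have hsa : IsSemialgebraicFunOn ℚ D
      (fun x => 2 * x (Fin.last (m + 1)) * ρ.cylinder.integrand (Fin.init x)) := by
    refine IsSemialgebraicFunOn.mul_holds ?_
      (ρ.cylinder.isSemialgebraicFunOn_integrand.comp_init_mono hD band_subset_setOf_init_mem)
    exact (isSemialgebraicFunOn_aeval hD (C 2 * X (Fin.last (m + 1)) : MvPolynomial _ ℚ)).congr
      fun x _ => by simp
  have hint : IntegrableOn
      (fun x => 2 * x (Fin.last (m + 1)) * ρ.cylinder.integrand (Fin.init x)) D := by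
    have hg : IntegrableOn (fun x : Fin (m + 1 + 1) → ℝ => ρ.cylinder.integrand (Fin.init x))
        D :=
      (ρ.cylinder.integrableOn_slabDomain 0).mono_set hsub
    refine Integrable.bdd_mul (c := 2) hg ?_ ?_
    · exact (by fun_prop : Measurable fun x : Fin (m + 1 + 1) → ℝ =>
        2 * x (Fin.last (m + 1))).aestronglyMeasurable
    · refine (ae_restrict_iff' hDm).mpr (ae_of_all _ fun x hx => ?_)
      have h0 : (0 : ℝ) ≤ x (Fin.last (m + 1)) := hx.2.1
      rw [Real.norm_eq_abs, abs_of_nonneg (by positivity)]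
      linarith [(hx.2.2 : x (Fin.last (m + 1)) ≤ 1)]
  exact ⟨⟨D, _, hD, hsa, hint⟩, rfl, rfl⟩

/-- **Newton–Leibniz in `y`**: `[S] − [ρ.cylinder]` is one instance of Kontsevich–Zagier's
rule (3) with base `ρ.cylinder`, constant edges `0 ≤ 1` and primitive `F (v, y) = y² · ρ(w)`
(`∂F/∂y = 2 y ρ(w)`, `F (v, 1) − F (v, 0) = ρ(w)`).
[Kontsevich–Zagier 2001, §1.2, rule (3)] [folklore] -/
theorem of_innerBand_sub_of_cylinder_mem (ρ : IntegralRep m) (S : IntegralRep (m + 1 + 1))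
    (hSd : S.domain = KZlog.band ρ.cylinder.domain (fun _ => 0) (fun _ => 1))
    (hSi : S.integrand = fun x => 2 * x (Fin.last (m + 1)) * ρ.cylinder.integrand (Fin.init x)) :
    of S - of ρ.cylinder ∈ newtonLeibnizRel := by
  have hD : IsSemialgebraic ℚ S.domain := S.isSemialgebraic_domain
  refine ⟨m + 1, S, ρ.cylinder, fun _ => 0, fun _ => 1,
    fun x => x (Fin.last (m + 1)) ^ 2 * ρ.cylinder.integrand (Fin.init x), ?_, ?_, ?_,
    fun _ _ => zero_le_one, ?_, ?_, ?_, ?_, rfl⟩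
  · refine IsSemialgebraicFunOn.mul_holds ?_
      (ρ.cylinder.isSemialgebraicFunOn_integrand.comp_init_mono hD
        (by rw [hSd]; exact band_subset_setOf_init_mem))
    exact (isSemialgebraicFunOn_aeval hD (X (Fin.last (m + 1)) ^ 2 : MvPolynomial _ ℚ)).congr
      fun x _ => by simp
  · simpa using isSemialgebraicFunOn_ratCast ρ.cylinder.isSemialgebraic_domain 0
  · simpa using isSemialgebraicFunOn_ratCast ρ.cylinder.isSemialgebraic_domain 1
  · rw [hSd]; rfl
  · intro x _; simp only [Fin.snoc_last, Fin.init_snoc]; fun_prop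
  · intro x _ t _
    simp only [hSi, Fin.snoc_last, Fin.init_snoc]
    have h : HasDerivAt (fun s : ℝ => s ^ 2) (2 * t) t := by simpa using hasDerivAt_pow 2 t
    exact (h.mul_const _).congr_deriv (by ring)
  · intro x _; simp only [Fin.snoc_last, Fin.init_snoc]; ring

/-! ### The outer band: Newton–Leibniz in `s` over the base -/

/-- The outer band representation `T = [{(x, s) | x ∈ B, 0 ≤ s ≤ y(x)}, s · y⁻¹ · ρ(w)]` over
the base `B = {(u, w, y) | (u, w) ∈ ρ.cylinder, 0 < y ≤ 1}` exists (semialgebraic: coordinates,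
the inverse of a non-vanishing coordinate, and the cylinder integrand; integrable: `|s y⁻¹| ≤ 1`
on the band, times the doubled slab integrand). [Kontsevich–Zagier 2001, §1.2] [folklore] -/
theorem exists_outerBand (ρ : IntegralRep m) :
    ∃ T : IntegralRep (m + 1 + 1 + 1),
      T.domain = KZlog.band {x : Fin (m + 1 + 1) → ℝ | Fin.init x ∈ ρ.cylinder.domain ∧
          0 < x (Fin.last (m + 1)) ∧ x (Fin.last (m + 1)) ≤ 1} (fun _ => 0)
          (fun x => x (Fin.last (m + 1))) ∧
      T.integrand = fun z => z (Fin.last (m + 1 + 1)) * (Fin.init z (Fin.last (m + 1)))⁻¹ *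
          ρ.cylinder.integrand (Fin.init (Fin.init z)) := by
  set B : Set (Fin (m + 1 + 1) → ℝ) := {x | Fin.init x ∈ ρ.cylinder.domain ∧
    0 < x (Fin.last (m + 1)) ∧ x (Fin.last (m + 1)) ≤ 1}
  have hB : IsSemialgebraic ℚ B := isSemialgebraic_logBase ρ
  set D : Set (Fin (m + 1 + 1 + 1) → ℝ) :=
    KZlog.band B (fun _ => 0) (fun x => x (Fin.last (m + 1)))
  have hD : IsSemialgebraic ℚ D :=
    KZlog.isSemialgebraic_band (by simpa using isSemialgebraicFunOn_ratCast hB 0)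
      (isSemialgebraicFunOn_apply hB (Fin.last (m + 1)))
  have hDm : MeasurableSet D := IsSemialgebraic.measurableSet_holds hD
  have hsub : D ⊆ (ρ.cylinder.slab 0).slabDomain 0 := fun z hz =>
    ⟨⟨hz.1.1, by simpa using hz.1.2.1.le, by simpa using hz.1.2.2⟩, by simpa using hz.2.1,
      by simpa using hz.2.2.trans hz.1.2.2⟩
  have hsa : IsSemialgebraicFunOn ℚ D (fun z => z (Fin.last (m + 1 + 1)) *
      (Fin.init z (Fin.last (m + 1)))⁻¹ * ρ.cylinder.integrand (Fin.init (Fin.init z))) := by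
    refine IsSemialgebraicFunOn.mul_holds (IsSemialgebraicFunOn.mul_holds
      (isSemialgebraicFunOn_apply hD (Fin.last (m + 1 + 1)))
      ((isSemialgebraicFunOn_apply hD (Fin.last (m + 1)).castSucc).inv fun z hz => ?_)) ?_
    · exact (hz.1.2.1).ne'
    · exact ρ.cylinder.isSemialgebraicFunOn_integrand.comp_init.comp_init.mono
        (fun z hz => hz.1.1) hD
  have hint : IntegrableOn (fun z => z (Fin.last (m + 1 + 1)) *
      (Fin.init z (Fin.last (m + 1)))⁻¹ * ρ.cylinder.integrand (Fin.init (Fin.init z))) D := by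
    have hg : IntegrableOn
        (fun z : Fin (m + 1 + 1 + 1) → ℝ => ρ.cylinder.integrand (Fin.init (Fin.init z))) D :=
      ((ρ.cylinder.slab 0).integrableOn_slabDomain 0).mono_set hsub
    refine Integrable.bdd_mul (c := 1) hg ?_ ?_
    · exact ((measurable_pi_apply (Fin.last (m + 1 + 1))).mul
        (measurable_pi_apply (Fin.last (m + 1)).castSucc).inv).aestronglyMeasurable
    · refine (ae_restrict_iff' hDm).mpr (ae_of_all _ fun z hz => ?_)
      have hy : (0 : ℝ) < Fin.init z (Fin.last (m + 1)) := hz.1.2.1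
      have h0 : (0 : ℝ) ≤ z (Fin.last (m + 1 + 1)) := hz.2.1
      have h1 : z (Fin.last (m + 1 + 1)) ≤ Fin.init z (Fin.last (m + 1)) := hz.2.2
      rw [Real.norm_eq_abs, abs_of_nonneg (mul_nonneg h0 (inv_nonneg.mpr hy.le)),
        ← div_eq_mul_inv, div_le_one hy]
      exact h1
  exact ⟨⟨D, _, hD, hsa, hint⟩, rfl, rfl⟩

/-- **Newton–Leibniz in `s`**: for the base representation `S₁ = [B, 2 y ρ(w)]` and the
quadrupled outer band `T₄ = [band, 4 s y⁻¹ ρ(w)]`, `[T₄] − [S₁]` is one instance of rule (3)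
with edges `0 ≤ y` and primitive `F (x, s) = 2 s² y⁻¹ ρ(w)` (`∂F/∂s = 4 s y⁻¹ ρ(w)`,
`F (x, y) − F (x, 0) = 2 y ρ(w)`). [Kontsevich–Zagier 2001, §1.2, rule (3)] [folklore] -/
theorem of_outerBand_sub_of_base_mem (ρ : IntegralRep m) (S₁ : IntegralRep (m + 1 + 1))
    (hS₁d : S₁.domain = {x : Fin (m + 1 + 1) → ℝ | Fin.init x ∈ ρ.cylinder.domain ∧
      0 < x (Fin.last (m + 1)) ∧ x (Fin.last (m + 1)) ≤ 1})
    (hS₁i : S₁.integrand =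
      fun x => 2 * x (Fin.last (m + 1)) * ρ.cylinder.integrand (Fin.init x))
    (T₄ : IntegralRep (m + 1 + 1 + 1))
    (hT₄d : T₄.domain = KZlog.band {x : Fin (m + 1 + 1) → ℝ | Fin.init x ∈ ρ.cylinder.domain
      ∧ 0 < x (Fin.last (m + 1)) ∧ x (Fin.last (m + 1)) ≤ 1} (fun _ => 0)
      (fun x => x (Fin.last (m + 1))))
    (hT₄i : T₄.integrand = fun z => 4 * (z (Fin.last (m + 1 + 1)) *
      (Fin.init z (Fin.last (m + 1)))⁻¹ * ρ.cylinder.integrand (Fin.init (Fin.init z)))) :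
    of T₄ - of S₁ ∈ newtonLeibnizRel := by
  have hD : IsSemialgebraic ℚ T₄.domain := T₄.isSemialgebraic_domain
  refine ⟨m + 1 + 1, T₄, S₁, fun _ => 0, fun x => x (Fin.last (m + 1)),
    fun z => 2 * z (Fin.last (m + 1 + 1)) ^ 2 * (Fin.init z (Fin.last (m + 1)))⁻¹ *
      ρ.cylinder.integrand (Fin.init (Fin.init z)), ?_, ?_, ?_, ?_, ?_, ?_, ?_, ?_, rfl⟩
  · refine IsSemialgebraicFunOn.mul_holds (IsSemialgebraicFunOn.mul_holds ?_
      ((isSemialgebraicFunOn_apply hD (Fin.last (m + 1)).castSucc).inv fun z hz => ?_)) ?_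
    · exact (isSemialgebraicFunOn_aeval hD
        (C 2 * X (Fin.last (m + 1 + 1)) ^ 2 : MvPolynomial _ ℚ)).congr fun z _ => by simp
    · rw [hT₄d] at hz
      exact (hz.1.2.1).ne'
    · exact ρ.cylinder.isSemialgebraicFunOn_integrand.comp_init.comp_init.mono
        (fun z hz => by rw [hT₄d] at hz; exact hz.1.1) hD
  · simpa using isSemialgebraicFunOn_ratCast S₁.isSemialgebraic_domain 0
  · exact isSemialgebraicFunOn_apply S₁.isSemialgebraic_domain (Fin.last (m + 1))
  · intro x hx
    rw [hS₁d] at hx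
    exact hx.2.1.le
  · rw [hT₄d, hS₁d]; rfl
  · intro x _; simp only [Fin.snoc_last, Fin.init_snoc]; fun_prop
  · intro x _ t _
    simp only [hT₄i, Fin.snoc_last, Fin.init_snoc]
    have h : HasDerivAt (fun s : ℝ => s ^ 2) (2 * t) t := by simpa using hasDerivAt_pow 2 t
    exact (((h.const_mul 2).mul_const _).mul_const _).congr_deriv (by ring)
  · intro x hx
    rw [hS₁d] at hx
    have hx0 : x (Fin.last (m + 1)) ≠ 0 := (hx.2.1).ne'
    simp only [hS₁i, Fin.snoc_last, Fin.init_snoc]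
    field_simp
    ring

/-- **The `s`-weighted log band is a quarter of its coefficient**: for the outer band
`T = [{0 ≤ s ≤ y, 0 < y ≤ 1, (u, w) ∈ ρ.cylinder}, s y⁻¹ ρ(w)]` one has
`4 • [T] − [ρ] ∈ KZ.relations`: `4 [T] ≡ [4 T]` (integrand additivity), `[4 T] ≡ [B, 2 y ρ]`
(Newton–Leibniz in `s`), `[B, 2 y ρ] ≡ [band, 2 y ρ]` (null face `{y = 0}`), `≡ [ρ.cylinder]`
(Newton–Leibniz in `y`), `≡ [ρ]` (`of_cylinder_sub_of_mem_relations`).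
[Kontsevich–Zagier 2001, §1.2] [folklore] -/
theorem exists_outerBand_four_nsmul_sub_mem (ρ : IntegralRep m) :
    ∃ T : IntegralRep (m + 1 + 1 + 1),
      T.domain = KZlog.band {x : Fin (m + 1 + 1) → ℝ | Fin.init x ∈ ρ.cylinder.domain ∧
          0 < x (Fin.last (m + 1)) ∧ x (Fin.last (m + 1)) ≤ 1} (fun _ => 0)
          (fun x => x (Fin.last (m + 1))) ∧
      (T.integrand = fun z => z (Fin.last (m + 1 + 1)) * (Fin.init z (Fin.last (m + 1)))⁻¹ *
          ρ.cylinder.integrand (Fin.init (Fin.init z))) ∧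
      4 • of T - of ρ ∈ relations := by
  set B : Set (Fin (m + 1 + 1) → ℝ) := {x | Fin.init x ∈ ρ.cylinder.domain ∧
    0 < x (Fin.last (m + 1)) ∧ x (Fin.last (m + 1)) ≤ 1}
  have hB : IsSemialgebraic ℚ B := isSemialgebraic_logBase ρ
  obtain ⟨S, hSd, hSi⟩ := exists_innerBand ρ
  obtain ⟨T, hTd, hTi⟩ := exists_outerBand ρ
  -- the null face `{y = 0}`
  have hBsub : B ⊆ S.domain := fun x hx => by rw [hSd]; exact ⟨hx.1, hx.2.1.le, hx.2.2⟩
  have hnull : volume (S.domain \ B) = 0 := by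
    refine measure_mono_null (fun x hx => ?_) (volume_setOf_last_eq_zero (n := m + 1) 0)
    obtain ⟨hxS, hxB⟩ := hx
    rw [hSd] at hxS
    obtain ⟨hv, h0, h1⟩ := hxS
    simp only [mem_setOf_eq]
    by_contra hne
    exact hxB ⟨hv, lt_of_le_of_ne h0 (Ne.symm hne), h1⟩
  set S₁ : IntegralRep (m + 1 + 1) := S.restrict B hB hBsub with hS₁_def
  have h1 : of S - of S₁ ∈ relations := S.of_sub_of_restrict_mem_relations hB hBsub hnull
  have h2 : of S - of ρ.cylinder ∈ relations :=
    newtonLeibnizRel_subset_relations (of_innerBand_sub_of_cylinder_mem ρ S hSd hSi)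
  -- the quadrupled band
  obtain ⟨T₄, hT₄d, hT₄i⟩ : ∃ T₄ : IntegralRep (m + 1 + 1 + 1),
      T₄.domain = T.domain ∧ T₄.integrand = fun z => 4 * T.integrand z :=
    ⟨⟨T.domain, fun z => 4 * T.integrand z, T.isSemialgebraic_domain,
      IsSemialgebraicFunOn.mul_holds
        (by simpa using isSemialgebraicFunOn_ratCast T.isSemialgebraic_domain 4)
        T.isSemialgebraicFunOn_integrand,
      T.integrableOn.const_mul 4⟩, rfl, rfl⟩
  have h3 : of T₄ - of S₁ ∈ relations := by
    refine newtonLeibnizRel_subset_relations (of_outerBand_sub_of_base_mem ρ S₁ rfl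
      (by rw [hS₁_def, IntegralRep.integrand_restrict, hSi]) T₄ (by rw [hT₄d, hTd]) ?_)
    rw [hT₄i, hTi]
  have h4 : of T₄ - of T - ∑ _i : Fin 3, of T ∈ relations := by
    refine of_sub_of_sub_sum_mem_relations 3 T₄ T (fun _ => T) hT₄d.symm (fun _ => hT₄d.symm)
      fun z _ => ?_
    simp only [hT₄i, Finset.sum_const, Finset.card_univ, Fintype.card_fin, nsmul_eq_mul]
    ring
  have hsum : ∑ _i : Fin 3, of T = 3 • of T := by
    rw [Finset.sum_const, Finset.card_univ, Fintype.card_fin]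
  rw [hsum] at h4
  have h5 : of ρ.cylinder - of ρ ∈ relations := of_cylinder_sub_of_mem_relations ρ
  refine ⟨T, hTd, hTi, ?_⟩
  have : 4 • of T - of ρ = -(of T₄ - of T - 3 • of T) + (of T₄ - of S₁) - (of S - of S₁)
      + (of S - of ρ.cylinder) + (of ρ.cylinder - of ρ) := by
    abel
  rw [this]
  exact relations.add_mem (relations.add_mem (relations.sub_mem (relations.add_mem
    (relations.neg_mem h4) h3) h1) h2) h5

/-! ### The stub -/

/-- **Stub `stub_logFamily_weighted_total` of the crux `CTConstruction`**
(stmt-KontsevichZagierPeriods-3495, line `registered`): for the log-elementary divergent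
product `P` with `p = 0`, `b = 1` over `r : IntegralRep d` and its `s`-weighted version `P'`
(`P'.domain = P.domain ∩ {0 < s < 1}`, `P'.integrand = s · P.integrand`),
`4 • [P'] − [r] ∈ KZ.relations` (the class-level form of `∫₀¹ s log (1/s) ds = 1/4`). Proof:
relabel the coordinates `(s, u, y, w) ↦ (u, w, y, s)` (`KZ.of_sub_of_reindex_mem_relations`),
close the band by the null faces `{s = 0} ∪ {s = 1}`
(`KZ.IntegralRep.of_sub_of_restrict_mem_relations`), and apply
`exists_outerBand_four_nsmul_sub_mem`. [Kontsevich–Zagier 2001, §1.2] [folklore] -/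
theorem stub_logFamily_weighted_total : ∀ (q d : ℕ) (r : Literature.NumberTheory.Transcendental.KZ.IntegralRep d) (P P' : Literature.NumberTheory.Transcendental.KZ.IntegralRep (1 + d + 1 + 1)), 0 < q → P.domain = {z | ∃ (s u : ℝ) (y : Fin 1 → ℝ) (w : Fin d → ℝ), z = Matrix.vecCons s (Matrix.vecCons u (Fin.append y w)) ∧ 0 < s ∧ s < 1 ∧ 0 < u ∧ u ^ q * s ^ 0 < 1 ∧ (∀ j, s ≤ y j ∧ y j ≤ 1) ∧ w ∈ r.domain} → P.integrand = (fun z => (∏ j : Fin 1, (z (Fin.castAdd d j).succ.succ)⁻¹) * r.integrand (fun l : Fin d => z (Fin.natAdd 1 l).succ.succ)) → P'.domain = P.domain ∩ Literature.NumberTheory.Transcendental.KZ.paramSlab (1 + d + 1) 0 1 → P'.integrand = (fun z => z 0 ^ 1 * P.integrand z) → 4 • Literature.NumberTheory.Transcendental.KZ.of P' - Literature.NumberTheory.Transcendental.KZ.of r ∈ Literature.NumberTheory.Transcendental.KZ.relations := by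
  intro q d r P P' hq hPd hPi hP'd hP'i
  obtain ⟨e, he0, he1, he2, he3⟩ := exists_coordPerm d
  obtain ⟨T, hTd, hTi, hT⟩ := exists_outerBand_four_nsmul_sub_mem r
  -- membership in the relabelled domain `(P'.reindex e).domain` and in the band `T.domain`
  have hAmem : ∀ w : Fin (d + 1 + 1 + 1) → ℝ, w ∈ (P'.reindex e).domain ↔
      ((0 < w (Fin.last (d + 1 + 1)) ∧ w (Fin.last (d + 1 + 1)) < 1 ∧ 0 < w 0 ∧
        w 0 ^ q < 1 ∧ (w (Fin.last (d + 1 + 1)) ≤ w (Fin.last (d + 1)).castSucc ∧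
          w (Fin.last (d + 1)).castSucc ≤ 1) ∧
        (fun l : Fin d => w l.succ.castSucc.castSucc) ∈ r.domain) ∧
      0 < w (Fin.last (d + 1 + 1)) ∧ w (Fin.last (d + 1 + 1)) < 1) := by
    intro w
    rw [IntegralRep.reindex_domain, hP'd, hPd, elementaryDomain_eq]
    simp only [mem_inter_iff, mem_setOf_eq, mem_paramSlab, he0, he1, he2, he3, Fin.forall_fin_one,
      pow_zero, mul_one, Rat.cast_zero, Rat.cast_one]
  have hTmem : ∀ w : Fin (d + 1 + 1 + 1) → ℝ, w ∈ T.domain ↔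
      (((0 < w 0 ∧ w 0 < 1 ∧ (fun l : Fin d => w l.succ.castSucc.castSucc) ∈ r.domain) ∧
        0 < w (Fin.last (d + 1)).castSucc ∧ w (Fin.last (d + 1)).castSucc ≤ 1) ∧
      0 ≤ w (Fin.last (d + 1 + 1)) ∧
        w (Fin.last (d + 1 + 1)) ≤ w (Fin.last (d + 1)).castSucc) := by
    intro w
    rw [hTd]
    exact Iff.rfl
  have hAsub : (P'.reindex e).domain ⊆ T.domain := by
    intro w hw
    obtain ⟨⟨hs0, -, hu0, hu1, ⟨hsy, hy1⟩, hwt⟩, -, -⟩ := (hAmem w).mp hw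
    exact (hTmem w).mpr ⟨⟨⟨hu0, (pow_lt_one_iff_of_nonneg hu0.le hq.ne').mp hu1, hwt⟩,
      hs0.trans_le hsy, hy1⟩, hs0.le, hsy⟩
  have hnull : volume (T.domain \ (P'.reindex e).domain) = 0 := by
    refine measure_mono_null (fun w hw => ?_) (measure_union_null
      (volume_setOf_last_eq_zero (n := d + 1 + 1) 0) (volume_setOf_last_eq_zero (n := d + 1 + 1) 1))
    obtain ⟨hwT, hwA⟩ := hw
    obtain ⟨⟨⟨hu0, hu1, hwt⟩, -, hy1⟩, hs0, hsy⟩ := (hTmem w).mp hwT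
    simp only [mem_union, mem_setOf_eq]
    by_cases h0 : w (Fin.last (d + 1 + 1)) = 0
    · exact Or.inl h0
    by_cases h1 : w (Fin.last (d + 1 + 1)) = 1
    · exact Or.inr h1
    exfalso
    have hs0' : 0 < w (Fin.last (d + 1 + 1)) := lt_of_le_of_ne hs0 (Ne.symm h0)
    have hs1' : w (Fin.last (d + 1 + 1)) < 1 := lt_of_le_of_ne (hsy.trans hy1) h1
    exact hwA ((hAmem w).mpr ⟨⟨hs0', hs1', hu0,
      (pow_lt_one_iff_of_nonneg hu0.le hq.ne').mpr hu1, ⟨hsy, hy1⟩, hwt⟩, hs0', hs1'⟩)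
  have hEq : EqOn T.integrand (P'.reindex e).integrand (P'.reindex e).domain := by
    intro w _
    simp only [hTi, IntegralRep.reindex_integrand, hP'i, hPi, he0, he2, he3, Fin.prod_univ_one,
      pow_one, IntegralRep.integrand_cylinder]
    rw [mul_assoc]
    rfl
  -- the chain of moves
  set TA : IntegralRep (d + 1 + 1 + 1) :=
    T.restrict (P'.reindex e).domain (P'.reindex e).isSemialgebraic_domain hAsub with hTA_def
  have h1 : of P' - of (P'.reindex e) ∈ relations := of_sub_of_reindex_mem_relations P' e
  have h2 : of T - of TA ∈ relations :=
    T.of_sub_of_restrict_mem_relations (P'.reindex e).isSemialgebraic_domain hAsub hnull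
  have h3 : of TA - of (P'.reindex e) ∈ relations := of_sub_of_mem_relations_of_eqOn rfl hEq
  have : 4 • of P' - of r = 4 • ((of P' - of (P'.reindex e)) - (of TA - of (P'.reindex e)) -
      (of T - of TA)) + (4 • of T - of r) := by
    abel
  rw [this]
  exact relations.add_mem
    (relations.nsmul_mem (relations.sub_mem (relations.sub_mem h1 h3) h2) 4) hT

end Summit.KontsevichZagierPeriods.ValuedFieldSpecialisation
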